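import Summits.PneNP.PneNP.Theorems.KarlinRubinMonotoneSufficesTransportSlices

/-!
# Crux `MonotoneSuffices` (stmt-PneNP-18026), line `Sketch` — BLOCK PINNING, part 1: counting

The block-pinning lever: if the non-monotone part of a detector reads only a block `F` of coordinates,
FIX the block. For `w, x : α → Bool` the MERGE `merge_F w x` takes the coordinates in `F` from `w` and
the others from `x` (`fun a => if a ∈ F then w a else x a`). Averaging over the pinned values `w`:

* `sum_card_merge_eq` — **null, exact**: `∑_w #{x : f (merge w x)} = 2^N · #{y : f y}` — the map
  `(w, x) ↦ (merge w x, merge x w)` is an involution of the square of the cube;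
* `sum_card_merge_supset_eq` — **planted, protected set off the block, exact**: for `K` disjoint from
  `F`, `∑_w #{x ⊇ K : ¬ f (merge w x)} = 2^N · #{y ⊇ K : ¬ f y}` (`K ⊆ supp` only constrains
  coordinates off `F`, where `merge w x` agrees with `x`);
* `sum_card_merge_supset_le` / `card_supset_mul_two_pow` — **planted, protected set meeting the block**:
  the trivial bound `≤ 2^N · #{x ⊇ K} = 2^N · 2^{N - #K}`.

So a uniformly random pinning reproduces both laws exactly except for the planted sets meeting `F`
(part 2 bounds their fraction by `#F · k(k-1)/(n(n-1))` — via `card_powersetCard_pair_le` and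
`choose_sub_two_mul` below — and picks a pinning below the average).
-/

set_option linter.dupNamespace false -- `Summit.PneNP.PneNP.…`: summit = sub-problem name (D-0017 single-conjunct layout)

namespace Summit.PneNP.PneNP.Theorems.MonotoneSuffices.BlockPinning

open Finset

variable {α : Type*} [DecidableEq α]

/-! ### The merge involution -/

/-- Merging twice in opposite orders returns the first argument on `F` and … [folklore] -/
theorem merge_merge (F : Finset α) (w x : α → Bool) :
    (fun a => if a ∈ F then (fun a => if a ∈ F then w a else x a) a
      else (fun a => if a ∈ F then x a else w a) a) = w := by
  funext a
  by_cases ha : a ∈ F <;> simp [ha]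

/-- **The merge involution** of the square of the cube: `(w, x) ↦ (merge w x, merge x w)`. [folklore] -/
theorem merge_involutive (F : Finset α) :
    Function.Involutive (fun p : (α → Bool) × (α → Bool) =>
      ((fun a => if a ∈ F then p.1 a else p.2 a), (fun a => if a ∈ F then p.2 a else p.1 a))) := by
  intro p
  ext a <;> by_cases ha : a ∈ F <;> simp [ha]

/-- Reindexing a double sum over the cube by the merge involution:
`∑_{w,x} g (merge w x) = 2^N · ∑_y g y`. [folklore] -/
theorem sum_sum_merge_eq [Fintype α] (F : Finset α) (g : (α → Bool) → ℝ) :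
    ∑ w : α → Bool, ∑ x : α → Bool, g (fun a => if a ∈ F then w a else x a) =
      (2 : ℝ) ^ Fintype.card α * ∑ y : α → Bool, g y := by
  have hΦ := merge_involutive F
  set Φ : (α → Bool) × (α → Bool) ≃ (α → Bool) × (α → Bool) := hΦ.toPerm _ with hΦdef
  calc ∑ w : α → Bool, ∑ x : α → Bool, g (fun a => if a ∈ F then w a else x a)
      = ∑ p : (α → Bool) × (α → Bool), g (Φ p).1 := by
        rw [← Fintype.sum_prod_type']
        rfl
    _ = ∑ p : (α → Bool) × (α → Bool), g p.1 := Φ.sum_comp (fun p => g p.1)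
    _ = ∑ y : α → Bool, ∑ _z : α → Bool, g y := Fintype.sum_prod_type _
    _ = (2 : ℝ) ^ Fintype.card α * ∑ y : α → Bool, g y := by
        rw [mul_sum]
        refine sum_congr rfl fun y _ => ?_
        rw [sum_const, card_univ, Fintype.card_fun, Fintype.card_bool, nsmul_eq_mul]
        push_cast
        ring

/-! ### Null: exact -/

/-- **Null law under a random pinning, exact**: `∑_w #{x : f (merge w x)} = 2^N · #{y : f y}`.
[folklore] -/
theorem sum_card_merge_eq [Fintype α] (F : Finset α) (f : (α → Bool) → Bool) :
    ∑ w : α → Bool, (#((univ : Finset (α → Bool)).filter fun x =>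
        f (fun a => if a ∈ F then w a else x a) = true) : ℝ) =
      (2 : ℝ) ^ Fintype.card α * #((univ : Finset (α → Bool)).filter fun y => f y = true) := by
  have h := sum_sum_merge_eq F (fun y => if f y = true then (1 : ℝ) else 0)
  simp only [sum_boole] at h
  rw [← h]

/-! ### Planted: exact off the block, bounded on it -/

/-- **Planted law under a random pinning, protected set off the block, exact**: for `K` disjoint from
`F`, `∑_w #{x ⊇ K : ¬ f (merge w x)} = 2^N · #{y ⊇ K : ¬ f y}`. [folklore] -/
theorem sum_card_merge_supset_eq [Fintype α] (F K : Finset α) (hKF : Disjoint K F) (f : (α → Bool) → Bool) :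
    ∑ w : α → Bool, (#((univ : Finset (α → Bool)).filter fun x =>
        K ⊆ (univ.filter fun a => x a = true) ∧ f (fun a => if a ∈ F then w a else x a) = false) : ℝ) =
      (2 : ℝ) ^ Fintype.card α *
        #((univ : Finset (α → Bool)).filter fun y => K ⊆ (univ.filter fun a => y a = true) ∧ f y = false) := by
  -- `K ⊆ supp x ↔ K ⊆ supp (merge w x)` since `K` misses `F`
  have hsupp : ∀ w x : α → Bool, K ⊆ (univ.filter fun a => x a = true) ↔
      K ⊆ univ.filter fun a => (if a ∈ F then w a else x a) = true := by
    intro w x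
    have hnot : ∀ a ∈ K, a ∉ F := fun a ha haF => disjoint_left.1 hKF ha haF
    constructor
    · intro h a ha
      have := (mem_filter.1 (h ha)).2
      exact mem_filter.2 ⟨mem_univ _, by simp [hnot a ha, this]⟩
    · intro h a ha
      have := (mem_filter.1 (h ha)).2
      simp only [hnot a ha, ↓reduceIte] at this
      exact mem_filter.2 ⟨mem_univ _, this⟩
  have h := sum_sum_merge_eq F (fun y => if (K ⊆ (univ.filter fun a => y a = true) ∧ f y = false) then (1 : ℝ) else 0)
  simp only [sum_boole] at h
  rw [← h]
  refine sum_congr rfl fun w _ => ?_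
  congr 1
  exact congrArg Finset.card (filter_congr fun x _ => by rw [hsupp w x])

/-- **Protected set meeting the block**: the trivial bound `∑_w #{x ⊇ K : …} ≤ 2^N · #{x ⊇ K}`.
[folklore] -/
theorem sum_card_merge_supset_le [Fintype α] (F K : Finset α) (f : (α → Bool) → Bool) :
    ∑ w : α → Bool, (#((univ : Finset (α → Bool)).filter fun x =>
        K ⊆ (univ.filter fun a => x a = true) ∧ f (fun a => if a ∈ F then w a else x a) = false) : ℝ) ≤
      (2 : ℝ) ^ Fintype.card α * #((univ : Finset (α → Bool)).filter fun y => K ⊆ univ.filter fun a => y a = true) := by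
  calc ∑ w : α → Bool, (#((univ : Finset (α → Bool)).filter fun x =>
        K ⊆ (univ.filter fun a => x a = true) ∧ f (fun a => if a ∈ F then w a else x a) = false) : ℝ)
      ≤ ∑ _w : α → Bool, (#((univ : Finset (α → Bool)).filter fun y => K ⊆ univ.filter fun a => y a = true) : ℝ) := by
        refine sum_le_sum fun w _ => ?_
        have hsub : ((univ : Finset (α → Bool)).filter fun x =>
            K ⊆ (univ.filter fun a => x a = true) ∧ f (fun a => if a ∈ F then w a else x a) = false) ⊆
            (univ : Finset (α → Bool)).filter fun y => K ⊆ univ.filter fun a => y a = true := by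
          intro x hx
          rw [mem_filter] at hx ⊢
          exact ⟨hx.1, hx.2.1⟩
        exact_mod_cast card_le_card hsub
    _ = _ := by
        rw [sum_const, card_univ, Fintype.card_fun, Fintype.card_bool, nsmul_eq_mul]
        push_cast
        ring

/-- **The vectors containing `K` number `2^{N - #K}`**: `#{y ⊇ K} · 2^{#K} = 2^N` (planting is
`2^{#K}`-to-one, `sum_plant_eq`). [folklore] -/
theorem card_supset_mul_two_pow [Fintype α] (K : Finset α) :
    (#((univ : Finset (α → Bool)).filter fun y => K ⊆ univ.filter fun a => y a = true) : ℝ) * (2 : ℝ) ^ #K =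
      (2 : ℝ) ^ Fintype.card α := by
  have h := SliceTransport.sum_plant_eq K (fun _ => (1 : ℝ))
  rw [sum_const, card_univ, Fintype.card_fun, Fintype.card_bool, nsmul_eq_mul, mul_one, sum_const,
    nsmul_eq_mul, mul_one] at h
  push_cast at h
  linarith

/-! ### Subsets containing a fixed pair -/

/-- The `m`-subsets of `s` containing two fixed distinct elements number at most `C(#s - 2, m - 2)`.
[folklore] -/
theorem card_powersetCard_pair_le {β : Type*} [DecidableEq β] (s : Finset β) {u v : β} (huv : u ≠ v)
    (hu : u ∈ s) (hv : v ∈ s) (m : ℕ) :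
    #((s.powersetCard m).filter fun A => u ∈ A ∧ v ∈ A) ≤ (#s - 2).choose (m - 2) := by
  classical
  have hP : ({u, v} : Finset β) ⊆ s := by
    intro w hw
    simp only [mem_insert, mem_singleton] at hw
    rcases hw with rfl | rfl <;> assumption
  have hcard2 : #({u, v} : Finset β) = 2 := card_pair huv
  rw [← hcard2, ← card_sdiff_of_subset hP, ← card_powersetCard]
  refine card_le_card_of_injOn (fun A => A \ {u, v}) (fun A hA => ?_) (fun A₁ hA₁ A₂ hA₂ h => ?_)
  · simp only [coe_filter, Set.mem_setOf_eq, mem_powersetCard] at hA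
    have hPA : ({u, v} : Finset β) ⊆ A := by
      intro w hw
      simp only [mem_insert, mem_singleton] at hw
      rcases hw with rfl | rfl
      · exact hA.2.1
      · exact hA.2.2
    rw [mem_coe, mem_powersetCard]
    refine ⟨sdiff_subset_sdiff hA.1.1 Subset.rfl, ?_⟩
    rw [card_sdiff_of_subset hPA, hA.1.2, hcard2]
  · simp only [coe_filter, Set.mem_setOf_eq, mem_powersetCard] at hA₁ hA₂
    have h1 : ({u, v} : Finset β) ⊆ A₁ := by
      intro w hw
      simp only [mem_insert, mem_singleton] at hw
      rcases hw with rfl | rfl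
      · exact hA₁.2.1
      · exact hA₁.2.2
    have h2 : ({u, v} : Finset β) ⊆ A₂ := by
      intro w hw
      simp only [mem_insert, mem_singleton] at hw
      rcases hw with rfl | rfl
      · exact hA₂.2.1
      · exact hA₂.2.2
    have := congrArg (fun D => D ∪ {u, v}) h
    simp only [sdiff_union_of_subset h1, sdiff_union_of_subset h2] at this
    exact this

/-- `C(n-2, m-2) · n(n-1) = C(n, m) · m(m-1)` for `2 ≤ m ≤ n`. [folklore] -/
theorem choose_sub_two_mul {n m : ℕ} (h2 : 2 ≤ m) (hmn : m ≤ n) :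
    (n - 2).choose (m - 2) * (n * (n - 1)) = n.choose m * (m * (m - 1)) := by
  obtain ⟨m', rfl⟩ : ∃ m', m = m' + 2 := ⟨m - 2, by omega⟩
  obtain ⟨n', rfl⟩ : ∃ n', n = n' + 2 := ⟨n - 2, by omega⟩
  simp only [Nat.add_sub_cancel]
  have h1 := Nat.add_one_mul_choose_eq n' m'          -- (n'+1) C(n',m') = C(n'+1,m'+1) (m'+1)
  have h2 := Nat.add_one_mul_choose_eq (n' + 1) (m' + 1) -- (n'+2) C(n'+1,m'+1) = C(n'+2,m'+2) (m'+2)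
  have e1 : n' + 2 - 1 = n' + 1 := rfl
  have e2 : m' + 2 - 1 = m' + 1 := rfl
  rw [e1, e2]
  calc n'.choose m' * ((n' + 2) * (n' + 1)) = (n' + 2) * ((n' + 1) * n'.choose m') := by ring
    _ = (n' + 2) * ((n' + 1).choose (m' + 1) * (m' + 1)) := by rw [h1]
    _ = ((n' + 2) * (n' + 1).choose (m' + 1)) * (m' + 1) := by ring
    _ = ((n' + 2).choose (m' + 2) * (m' + 2)) * (m' + 1) := by rw [h2]
    _ = (n' + 2).choose (m' + 2) * ((m' + 2) * (m' + 1)) := by ring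

/-- **pinning_count** (registered helper sub-goal of stmt-PneNP-18026, block pinning, part 1): a
uniformly random pinning of a block reproduces the uniform law exactly (`sum_card_merge_eq`).
[folklore] -/
theorem pinning_count :
    ∀ {α : Type*} [Fintype α] [DecidableEq α] (F : Finset α) (f : (α → Bool) → Bool), ∑ w : α → Bool, (#((Finset.univ : Finset (α → Bool)).filter fun x => f (fun a => if a ∈ F then w a else x a) = true) : ℝ) = (2 : ℝ) ^ Fintype.card α * #((Finset.univ : Finset (α → Bool)).filter fun y => f y = true) :=
  fun F f => sum_card_merge_eq F f

end Summit.PneNP.PneNP.Theorems.MonotoneSuffices.BlockPinning
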